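/-
Copyright: b2b-lace packet (explicit-unit carver, gen 19).  The hinge between the letter interface of `NobleBlocks`
(lower indices `LenIdx.ge m` / `LenIdx.eq m`) and the percolation events of `NobleBoundsN0` / `NobleExactLengthLines`:
the event `{x ←j→ y}` and the two-point letter `τ_{j,p}` of a lower index `j`.  Definitions and kernel lemmas only; no
named fact; no numeral; no dimension is fixed.
-/
import Literature.Probability.FitznerVanDerHofstad2017.NobleBlocks
import Literature.Probability.FitznerVanDerHofstad2017.NobleExactLengthLines
import HarnessLib

/-!
# [FvdH17] §4.2: the event and the two-point letter of a lower index `j ∈ {m, m̲}`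

Source: R. Fitzner, R. van der Hofstad, *Mean-field behavior for nearest-neighbor percolation in `d > 10`*,
Electron. J. Probab. **22** (2017) no. 43 [FvdH17]; arXiv:1506.07977v2 §4.2 "Modified two-point functions" (v2 p. 34):
"We define modified two-point functions for a lower index `j = m, m̲` by `τ_{j,p}(x) = P_p(0 ←j→ x)`."

`NobleBlocks.LenIdx` is the type of lower indices (`ge m` = `m`, `eq m` = `m̲`); `NobleBoundsN0.openConnGe` and
`NobleExactLengthLines.openConnEq` are the two events under the PATH READING.  This module sets
* `LenIdx.event j x y` = `{x ←j→ y}` (by cases), `LenIdx.floor j` (the number `m`), with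
  `{x ←j→ y} ⊆ {x ←m→ y}` (`event_subset_openConnGe`), the finitary/increasing/measurable bookkeeping, `{v ←j→ v} = ∅`
  for `m ≥ 1`, and relabelling;
* `LenIdx.tauIdx d p j x` = `τ_{j,p}(x)` (= `tauGe`/`tauEq` by cases) with `τ_{j,p} = P_p(0 ←j→ ·)`, `0 ≤ τ_{j,p} ≤ τ_{m,p} ≤ 1`,
  translation (`measureReal_event_eq_tauIdx`) and signed-permutation symmetry (`tauIdx_stepVec`).
It is the index-to-event map a `Letters d` INSTANCE (the percolation letters) is built from; nothing here bounds a diagram.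
-/

noncomputable section

namespace Literature.Probability.FitznerVanDerHofstad2017.NobleBlocks.LenIdx

open _root_.MeasureTheory Literature.Barriers.CriticalPhenomena Literature.Probability.Percolation
open Literature.Probability.LatticeModels Literature.Probability.FitznerVanDerHofstad2017
open scoped BigOperators ENNReal

local notation "𝐞" => Literature.Probability.Percolation.stepVec

section Events

variable {V W : Type*}

/-- The number `m` of a lower index `j ∈ {m, m̲}`. [cite: FitznerVanDerHofstad2017, §4.2 "Modified two-point functions" (arXiv:1506.07977v2 p. 34)] -/
def floor : LenIdx → ℕ
  | ge m => m
  | eq m => m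

/-- `floor (ge m) = m`. [folklore] -/
@[simp] theorem floor_ge (m : ℕ) : floor (ge m) = m := rfl

/-- `floor (eq m) = m`. [folklore] -/
@[simp] theorem floor_eq (m : ℕ) : floor (eq m) = m := rfl

/-- **`{x ←j→ y}`** for a lower index `j`: `{x ←m→ y}` (`openConnGe`) for `j = m`, `{x ←m̲→ y}` (`openConnEq`) for
`j = m̲`. [cite: FitznerVanDerHofstad2017, §4.2 "Modified two-point functions" (arXiv:1506.07977v2 p. 34)] -/
def event : LenIdx → V → V → Set (BondConfig V)
  | ge m, x, y => openConnGe m x y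
  | eq m, x, y => openConnEq m x y

/-- `event (ge m) = openConnGe m`. [folklore] -/
@[simp] theorem event_ge (m : ℕ) (x y : V) : event (ge m) x y = openConnGe m x y := rfl

/-- `event (eq m) = openConnEq m`. [folklore] -/
@[simp] theorem event_eq (m : ℕ) (x y : V) : event (eq m) x y = openConnEq m x y := rfl

/-- `{x ←j→ y} ⊆ {x ←m→ y}` (`m` the number of `j`). [cite: FitznerVanDerHofstad2017, §4.2 (4.1) (arXiv:1506.07977v2 p. 34)] -/
theorem event_subset_openConnGe (j : LenIdx) (x y : V) : (event j x y : Set (BondConfig V)) ⊆ openConnGe (floor j) x y := by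
  cases j with
  | ge m => exact subset_rfl
  | eq m => exact openConnEq_subset_openConnGe m x y

/-- `{x ←j→ y}` is increasing. [folklore] -/
theorem isUpperSet_event (j : LenIdx) (x y : V) : IsUpperSet (event j x y : Set (BondConfig V)) := by
  cases j with
  | ge m => exact isUpperSet_openConnGe m x y
  | eq m => exact isUpperSet_openConnEq x y m

/-- `{x ←j→ y}` is finitary. [folklore] -/
theorem isFinitary_event [DecidableEq V] (j : LenIdx) (x y : V) : IsFinitary (event j x y : Set (BondConfig V)) := by
  cases j with
  | ge m => exact isFinitary_openConnGe m x y
  | eq m => exact isFinitary_openConnEq x y m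

/-- `{x ←j→ y}` is measurable (`V` countable). [folklore] -/
theorem measurableSet_event [Countable V] (j : LenIdx) (x y : V) :
    MeasurableSet (event j x y : Set (BondConfig V)) := by
  classical
  exact (isFinitary_event j x y).measurableSet (isUpperSet_event j x y)

/-- `{v ←j→ v} = ∅` when the number of `j` is `≥ 1`. [folklore] -/
theorem event_self_eq_empty {j : LenIdx} (hj : floor j ≠ 0) (v : V) : (event j v v : Set (BondConfig V)) = ∅ :=
  Set.subset_eq_empty ((event_subset_openConnGe j v v).trans_eq (openConnGe_self_eq_empty hj v)) rfl

/-- Transport of `{x ←j→ y}` under a relabelling of the vertex set. [folklore] -/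
theorem relabel_mem_event_iff (φ : V ≃ W) (ω : BondConfig V) (j : LenIdx) (x y : V) :
    BondConfig.relabel (sym2Equiv φ) ω ∈ event j (φ x) (φ y) ↔ ω ∈ event j x y := by
  cases j with
  | ge m => exact relabel_mem_openConnGe_iff φ ω m x y
  | eq m => exact relabel_mem_openConnEq_iff φ ω m x y

end Events

/-! ### `τ_{j,p}` on `ℤ^d` -/

section Lattice

variable {d : ℕ}

/-- **`τ_{j,p}(x) = P_p(0 ←j→ x)`** for a lower index `j` (`tauGe` for `j = m`, `tauEq` for `j = m̲`).
[cite: FitznerVanDerHofstad2017, §4.2 "Modified two-point functions" (arXiv:1506.07977v2 p. 34)] -/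
def tauIdx (d : ℕ) (p : unitInterval) : LenIdx → Site d → ℝ
  | ge m, x => tauGe d p m x
  | eq m, x => tauEq d p m x

/-- `tauIdx (ge m) = tauGe m`. [folklore] -/
@[simp] theorem tauIdx_ge (p : unitInterval) (m : ℕ) (x : Site d) : tauIdx d p (ge m) x = tauGe d p m x := rfl

/-- `tauIdx (eq m) = tauEq m`. [folklore] -/
@[simp] theorem tauIdx_eq (p : unitInterval) (m : ℕ) (x : Site d) : tauIdx d p (eq m) x = tauEq d p m x := rfl

/-- `τ_{j,p}(x) = P_p(0 ←j→ x)`. [cite: FitznerVanDerHofstad2017, §4.2 (4.1) (arXiv:1506.07977v2 p. 34)] -/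
theorem tauIdx_eq_measureReal (p : unitInterval) (j : LenIdx) (x : Site d) :
    tauIdx d p j x = (bondPercolation (zdGraph d) p).real (event j 0 x) := by
  cases j <;> rfl

/-- `τ_{j,p} ≥ 0`. [folklore] -/
theorem tauIdx_nonneg (p : unitInterval) (j : LenIdx) (x : Site d) : 0 ≤ tauIdx d p j x := by
  rw [tauIdx_eq_measureReal]; exact measureReal_nonneg

/-- `τ_{j,p}(x) ≤ τ_{m,p}(x)` (`m` the number of `j`). [cite: FitznerVanDerHofstad2017, §4.2 (4.1) (arXiv:1506.07977v2 p. 34)] -/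
theorem tauIdx_le_tauGe_floor (p : unitInterval) (j : LenIdx) (x : Site d) : tauIdx d p j x ≤ tauGe d p (floor j) x := by
  cases j with
  | ge m => exact le_rfl
  | eq m => exact tauEq_le_tauGe p m x

/-- `τ_{j,p}(x) ≤ 1`. [folklore] -/
theorem tauIdx_le_one (p : unitInterval) (j : LenIdx) (x : Site d) : tauIdx d p j x ≤ 1 :=
  (tauIdx_le_tauGe_floor p j x).trans (tauGe_le_one p _ x)

/-- `τ_{j,p}(0) = 0` when the number of `j` is `≥ 1`. [cite: FitznerVanDerHofstad2017, §4.2 (4.1) (arXiv:1506.07977v2 p. 34)] -/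
theorem tauIdx_zero_of_ne (p : unitInterval) {j : LenIdx} (hj : floor j ≠ 0) : tauIdx d p j 0 = 0 := by
  rw [tauIdx_eq_measureReal, event_self_eq_empty hj]
  simp

/-- `P_p(v ←j→ x) = τ_{j,p}(x − v)` (translation invariance). [folklore] -/
theorem measureReal_event_eq_tauIdx (p : unitInterval) (j : LenIdx) (v x : Site d) :
    (bondPercolation (zdGraph d) p).real (event j v x) = tauIdx d p j (x - v) := by
  cases j with
  | ge m => exact measureReal_openConnGe_eq_tauGe p m v x
  | eq m => exact measureReal_openConnEq_eq_tauEq p m v x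

/-- `τ_{j,p}(φ x) = τ_{j,p}(x)` for a lattice automorphism fixing the origin. [folklore] -/
theorem tauIdx_iso (φ : zdGraph d ≃g zdGraph d) (hφ : φ 0 = 0) (p : unitInterval) (j : LenIdx) (x : Site d) :
    tauIdx d p j (φ x) = tauIdx d p j x := by
  cases j with
  | ge m => exact tauGe_iso φ hφ p m x
  | eq m => exact tauEq_iso φ hφ p m x

/-- `τ_{j,p}(e_ι) = τ_{j,p}(e₁)` for every unit step. [cite: FitznerVanDerHofstad2017, §4.2 (4.1) (arXiv:1506.07977v2 p. 34)] -/
theorem tauIdx_stepVec (hd : 1 ≤ d) (p : unitInterval) (j : LenIdx) (ι : Fin d × Bool) :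
    tauIdx d p j (𝐞 ι) = tauIdx d p j (unitSite1 d) := by
  cases j with
  | ge m => exact tauGe_stepVec hd p m ι
  | eq m => exact tauEq_stepVec hd p m ι

/-- The two-point letter field of a `Letters d` bundle built from percolation: `j ↦ x ↦ τ_{j,p}(x)` in `ℝ≥0∞`.
[cite: FitznerVanDerHofstad2017, §4.2 (4.1) (arXiv:1506.07977v2 p. 34)] -/
def tauLetter (d : ℕ) (p : unitInterval) : LenIdx → Site d → ℝ≥0∞ := fun j x => ENNReal.ofReal (tauIdx d p j x)

/-- `tauLetter ≤ 1`. [folklore] -/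
theorem tauLetter_le_one (p : unitInterval) (j : LenIdx) (x : Site d) : tauLetter d p j x ≤ 1 :=
  ENNReal.ofReal_le_one.2 (tauIdx_le_one p j x)

/-- `tauLetter (eq m) ≤ tauLetter (ge m)` (`τ_{m̲,p} ≤ τ_{m,p}`). [cite: FitznerVanDerHofstad2017, §4.2 (4.1) (arXiv:1506.07977v2 p. 34)] -/
theorem tauLetter_eq_le_ge (p : unitInterval) (m : ℕ) (x : Site d) : tauLetter d p (eq m) x ≤ tauLetter d p (ge m) x :=
  ENNReal.ofReal_le_ofReal (tauEq_le_tauGe p m x)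

end Lattice

end Literature.Probability.FitznerVanDerHofstad2017.NobleBlocks.LenIdx

end
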